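import Summits.CriticalPhenomena.CardyFormulaZ2.Theses.CardyMagicRigidity
import Summits.CriticalPhenomena.CardyFormulaZ2.Theorems.CardyMagicRigidityLoopsToCrossingsStubZdPlateDuality
import Summits.CriticalPhenomena.CardyFormulaZ2.Theorems.CardyMagicRigidityLoopsToCrossingsStubPlusBlocking
import Summits.CriticalPhenomena.CardyFormulaZ2.Theorems.CardyMagicRigidityLoopsToCrossingsStubTriPlateDuality
import Summits.CriticalPhenomena.CardyFormulaZ2.Theorems.CardyMagicRigidityLoopsToCrossingsStubTransferVerticalTtoZ
import Summits.CriticalPhenomena.CardyFormulaZ2.Theorems.CardyMagicRigidityLoopsToCrossingsStubZdLoopArc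
import Summits.CriticalPhenomena.CardyFormulaZ2.Theorems.CardyMagicRigidityLoopsToCrossingsStubTriBlockedByCloseArc
import Literature.Probability.Percolation.PlateCrossingEvents
import Literature.Probability.Percolation.ZdPlatePolarisation
import Literature.Probability.Percolation.TriPlatePolarisation
import Literature.Probability.Percolation.SquareModelPlateContainment
import Literature.Probability.Percolation.CommonOneArmWindow
import Literature.Probability.Percolation.CardyFormulaConformalInvariance
import Literature.Probability.Percolation.QuadCrossingSquareModel
import Literature.Probability.Percolation.FullPlaneCNL

/-!
# Stub C of line `oracle-sandwich` (crux `LoopsToCrossings`): loops transfer crossings, 𝕋 → ℤ² side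

`stub_transfer_tri_to_bond`: under `X = LoopLimitZ2EqT`, for every conformal rectangle `Q`, room
`r > 0` and `ε > 0`, eventually in `δ`, `tri(Q, δ) ≤ P_{ℤ²}(bond plate path of (Q, r)) + ε`.
Mono-polarisation engine in the coordinates of a square model `Φ` of `Q`:
S0 `plateContainment_holds`, S1 `polarZ_of` (from G1 `stub_zdPlateDuality`), S2 `polarT_of`
(from G2 `stub_triPlateDuality` and the G02 part of `stub_plusBlocking`), S3 `monoTransfer_of`
(coupling from `X` via `LoopConfig.exists_coupling_of_cnLawEDist_lt`, window `exists_common_oneArm_window`,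
the deterministic transfers T1 `stub_transferVerticalTtoZ` and T2 =
`stub_zdLoopArc` + `stub_triBlockedByCloseArc`), assembled by `transfer_of_pieces`.
-/

noncomputable section

namespace Summit.CriticalPhenomena.CardyFormulaZ2.Cruxes.LoopsToCrossings.OracleSandwich

open Summit.CriticalPhenomena.CardyFormulaZ2.Theses.CardyMagicRigidity
open Literature.Probability.RandomPlanarGeometry hiding cardyFunction
open Literature.Probability.Percolation hiding cardyFunction
open Literature.Probability.LatticeModels
open Filter Topology Set MeasureTheory Metric Complex

/-- S3 from the two deterministic transfers T1, T2, the two dualities G1, G2, the window bounds of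
the tree (`annulusOpenCrossing_half_le_holds`, `annulusDualCrossing_half_le_holds`,
`tri_annulusCrossing_bound_holds`) and the coupling provided by `X`
(`LoopConfig.exists_coupling_of_cnLawEDist_lt`). [folklore] -/
theorem monoTransfer_of
    (hG1 : ∀ (Φ : ℂ ≃ₜ ℂ) (ν : ℝ), 0 < ν → ∃ δ₀ : ℝ, 0 < δ₀ ∧ ∀ δ : ℝ, 0 < δ → δ ≤ δ₀ →
      ∀ ω : BondConfig (Site 2), ω ⊆ (zdGraph 2).edgeSet →
        (∀ x yin yout : ℝ, 2 * ν < x → x ≤ 2 → 0 < yin → yin + 2 * ν ≤ yout → yout ≤ 2 →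
          (ω ∉ zdPlateV (meshPoint δ) Φ x yin yout → dualConfig ω ∈ zdPlateH (dualDraw δ) Φ (x - 2 * ν) x (yin + 2 * ν)) ∧
          (dualConfig ω ∉ zdPlateV (dualDraw δ) Φ x yin yout → ω ∈ zdPlateH (meshPoint δ) Φ (x - 2 * ν) x (yin + 2 * ν))) ∧
        (∀ xin xout y : ℝ, 2 * ν < y → y ≤ 2 → 0 < xin → xin + 2 * ν ≤ xout → xout ≤ 2 →
          (ω ∉ zdPlateH (meshPoint δ) Φ xin xout y → dualConfig ω ∈ zdPlateV (dualDraw δ) Φ (xin + 2 * ν) (y - 2 * ν) y) ∧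
          (dualConfig ω ∉ zdPlateH (dualDraw δ) Φ xin xout y → ω ∈ zdPlateV (meshPoint δ) Φ (xin + 2 * ν) (y - 2 * ν) y)))
    (hG2 : ∀ (Φ : ℂ ≃ₜ ℂ) (ν : ℝ), 0 < ν → ∃ δ₀ : ℝ, 0 < δ₀ ∧ ∀ δ : ℝ, 0 < δ → δ ≤ δ₀ →
      ∀ ω : SiteConfig (Site 2),
        (∀ x yin yout : ℝ, 2 * ν < x → x ≤ 2 → 0 < yin → yin + 2 * ν ≤ yout → yout ≤ 2 →
          (ω ∉ triPlateV Φ δ x yin yout → ωᶜ ∈ triPlateH Φ δ (x - 2 * ν) x (yin + 2 * ν)) ∧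
          (ωᶜ ∉ triPlateV Φ δ x yin yout → ω ∈ triPlateH Φ δ (x - 2 * ν) x (yin + 2 * ν))) ∧
        (∀ xin xout y : ℝ, 2 * ν < y → y ≤ 2 → 0 < xin → xin + 2 * ν ≤ xout → xout ≤ 2 →
          (ω ∉ triPlateH Φ δ xin xout y → ωᶜ ∈ triPlateV Φ δ (xin + 2 * ν) (y - 2 * ν) y) ∧
          (ωᶜ ∉ triPlateH Φ δ xin xout y → ω ∈ triPlateV Φ δ (xin + 2 * ν) (y - 2 * ν) y)))
    (hT1 : ∀ (Φ : ℂ ≃ₜ ℂ) (c : ℝ), 0 < c → ∃ η₀ : ℝ, 0 < η₀ ∧ ∀ η : ℝ, 0 < η → η ≤ η₀ →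
      ∃ δ₀ : ℝ, 0 < δ₀ ∧ ∀ δ : ℝ, 0 < δ → δ ≤ δ₀ →
        ∀ (W₀ W₁ : ℝ), Φ '' plateBox 2 2 ⊆ ball (0 : ℂ) W₀ → W₀ < W₁ → W₁ + 1 ≤ 1 / η →
        ∀ (x yin yout : ℝ), c ≤ x → x + c ≤ 2 → 2 * c ≤ yin → yin ≤ yout → yout ≤ 2 →
        ∀ (ω : BondConfig (Site 2)) (ω' : SiteConfig (Site 2)), ω ⊆ (zdGraph 2).edgeSet →
          LoopConfig.IsClose η (bondLoopConfig δ 0 ω) (siteLoopConfig δ ω') →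
          (ω ∉ annulusOpenCrossing 0 δ W₀ W₁ ∧ ω ∉ annulusDualCrossing 0 δ W₀ W₁) →
            (ω' ∉ triAnnulusCrossing true δ 0 W₀ W₁ ∧ ω' ∉ triAnnulusCrossing false δ 0 W₀ W₁) →
          ω' ∈ triPlateV Φ δ x yin yout → ω'ᶜ ∈ triPlateV Φ δ x yin yout →
          ∀ xout : ℝ, xout ≤ 2 → ω ∉ zdMonoPlateH Φ δ (x + c) xout (yin - c))
    (hT2 : ∀ (Φ : ℂ ≃ₜ ℂ) (c : ℝ), 0 < c → ∃ η₀ : ℝ, 0 < η₀ ∧ ∀ η : ℝ, 0 < η → η ≤ η₀ →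
      ∃ δ₀ : ℝ, 0 < δ₀ ∧ ∀ δ : ℝ, 0 < δ → δ ≤ δ₀ →
        ∀ (W₀ W₁ : ℝ), Φ '' plateBox 2 2 ⊆ ball (0 : ℂ) W₀ → W₀ < W₁ → W₁ + 1 ≤ 1 / η →
        ∀ (xin xout y : ℝ), 2 * c ≤ xin → xin ≤ xout → xout ≤ 2 → c ≤ y → y + c ≤ 2 →
        ∀ (ω : BondConfig (Site 2)) (ω' : SiteConfig (Site 2)), ω ⊆ (zdGraph 2).edgeSet →
          LoopConfig.IsClose η (bondLoopConfig δ 0 ω) (siteLoopConfig δ ω') →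
          (ω ∉ annulusOpenCrossing 0 δ W₀ W₁ ∧ ω ∉ annulusDualCrossing 0 δ W₀ W₁) →
            (ω' ∉ triAnnulusCrossing true δ 0 W₀ W₁ ∧ ω' ∉ triAnnulusCrossing false δ 0 W₀ W₁) →
          ω ∈ zdPlateH (meshPoint δ) Φ xin xout y → dualConfig ω ∈ zdPlateH (dualDraw δ) Φ xin xout y →
          ∀ yout' : ℝ, yout' ≤ 2 → ω' ∉ triMonoPlateV Φ δ (xin - c) (y + c) yout') :
  LoopLimitZ2EqT → ∀ (Φ : ℂ ≃ₜ ℂ) (κ : ℝ), 0 < κ → κ ≤ 1 / 2 → ∀ ε : ℝ, 0 < ε →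
    ∀ᶠ δ : ℝ in 𝓝[>] 0,
      (triSitePercolation half).real (triMonoPlateV Φ δ (1 + 11 * κ / 20) (1 - 11 * κ / 20) (1 + 11 * κ / 20)) ≤
          (bondPercolation (zdGraph 2) half).real (zdMonoPlateV Φ δ (1 + 4 * κ / 5) (1 - 4 * κ / 5) (1 + 4 * κ / 5)) + ε ∧
        (bondPercolation (zdGraph 2) half).real (zdMonoPlateH Φ δ (1 + 3 * κ / 5) (1 + 4 * κ / 5) (1 - 3 * κ / 5)) ≤
          (triSitePercolation half).real (triMonoPlateH Φ δ (1 + 3 * κ / 10) (1 + 11 * κ / 20) (1 - 3 * κ / 10)) + ε := by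
  intro hX Φ κ hκ hκ1 ε hε
  -- rooms
  have hν : 0 < κ / 20 := by positivity
  have hc : 0 < 3 * κ / 20 := by positivity
  have hc' : 0 < κ / 5 := by positivity
  obtain ⟨δ₁, hδ₁, hdualZ⟩ := hG1 Φ (κ / 20) hν
  obtain ⟨δ₂, hδ₂, hdualT⟩ := hG2 Φ (κ / 20) hν
  obtain ⟨η₁, hη₁, hT1'⟩ := hT1 Φ (κ / 5) hc'
  obtain ⟨η₂, hη₂, hT2'⟩ := hT2 Φ (3 * κ / 20) hc
  -- window
  have hε4 : 0 < ε / 4 := by positivity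
  obtain ⟨W₀, W₁, hW₀, hW₀₁, hW, δw, hδw, hwin⟩ := exists_common_oneArm_window Φ hε4
  have hWc : Φ '' plateBox 2 2 ⊆ closedBall (0 : ℂ) W₀ := hW.trans ball_subset_closedBall
  -- the coupling scale
  have hW₁pos : 0 < W₁ + 1 := by linarith
  set η : ℝ := min (min η₁ η₂) (min (1 / (W₁ + 1)) (ε / 4)) with hηdef
  have hηpos : 0 < η := lt_min (lt_min hη₁ hη₂) (lt_min (one_div_pos.2 hW₁pos) hε4)
  have hηη₁ : η ≤ η₁ := (min_le_left _ _).trans (min_le_left _ _)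
  have hηη₂ : η ≤ η₂ := (min_le_left _ _).trans (min_le_right _ _)
  have hηW : W₁ + 1 ≤ 1 / η := by
    have h1 : η ≤ 1 / (W₁ + 1) := (min_le_right _ _).trans (min_le_left _ _)
    rw [le_div_iff₀ hηpos]
    have := (le_div_iff₀ hW₁pos).1 h1
    linarith
  have hηε : η ≤ ε / 4 := (min_le_right _ _).trans (min_le_right _ _)
  obtain ⟨δ₃, hδ₃, hT1''⟩ := hT1' η hηpos hηη₁
  obtain ⟨δ₄, hδ₄, hT2''⟩ := hT2' η hηpos hηη₂
  -- the coupling from `X`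
  have hX' : Tendsto (fun δ : ℝ ↦ LoopConfig.cnLawEDist (bondPercolation (zdGraph 2) half) (bondLoopConfig δ 0) (triSitePercolation half) (siteLoopConfig δ))
      (𝓝[>] 0) (𝓝 0) := hX
  have hevX : ∀ᶠ δ : ℝ in 𝓝[>] 0,
      LoopConfig.cnLawEDist (bondPercolation (zdGraph 2) half) (bondLoopConfig δ 0) (triSitePercolation half) (siteLoopConfig δ) < ENNReal.ofReal η :=
    hX' (Iio_mem_nhds (ENNReal.ofReal_pos.2 hηpos))
  have hevδ : ∀ᶠ δ : ℝ in 𝓝[>] 0, δ ∈ Ioo 0 (min (min (min δ₁ δ₂) (min δ₃ δ₄)) δw) :=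
    Ioo_mem_nhdsGT (lt_min (lt_min (lt_min hδ₁ hδ₂) (lt_min hδ₃ hδ₄)) hδw)
  filter_upwards [hevX, hevδ] with δ hXδ hδ
  have hδpos : 0 < δ := hδ.1
  have hδ₁' : δ ≤ δ₁ := (hδ.2.trans_le ((min_le_left _ _).trans ((min_le_left _ _).trans (min_le_left _ _)))).le
  have hδ₂' : δ ≤ δ₂ := (hδ.2.trans_le ((min_le_left _ _).trans ((min_le_left _ _).trans (min_le_right _ _)))).le
  have hδ₃' : δ ≤ δ₃ := (hδ.2.trans_le ((min_le_left _ _).trans ((min_le_right _ _).trans (min_le_left _ _)))).le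
  have hδ₄' : δ ≤ δ₄ := (hδ.2.trans_le ((min_le_left _ _).trans ((min_le_right _ _).trans (min_le_right _ _)))).le
  have hδw' : δ ≤ δw := (hδ.2.trans_le (min_le_right _ _)).le
  obtain ⟨P, hP1, hP2, hPbad⟩ := LoopConfig.exists_coupling_of_cnLawEDist_lt hXδ
  haveI : IsProbabilityMeasure P := by
    refine ⟨?_⟩
    have hu : P.map Prod.fst univ = 1 := by rw [hP1, measure_univ]
    rwa [Measure.map_apply measurable_fst MeasurableSet.univ, preimage_univ] at hu
  -- events
  set Cl : Set (BondConfig (Site 2) × SiteConfig (Site 2)) :=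
    {p | LoopConfig.IsClose η (bondLoopConfig δ 0 p.1) (siteLoopConfig δ p.2)} with hCl
  set GZ : Set (BondConfig (Site 2)) := {ω | (ω ∉ annulusOpenCrossing 0 δ W₀ W₁ ∧ ω ∉ annulusDualCrossing 0 δ W₀ W₁) ∧ ω ⊆ (zdGraph 2).edgeSet} with hGZ
  set GT : Set (SiteConfig (Site 2)) := {ω' | (ω' ∉ triAnnulusCrossing true δ 0 W₀ W₁ ∧ ω' ∉ triAnnulusCrossing false δ 0 W₀ W₁)} with hGT
  set MVZ : Set (BondConfig (Site 2)) := zdMonoPlateV Φ δ (1 + 4 * κ / 5) (1 - 4 * κ / 5) (1 + 4 * κ / 5) with hMVZ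
  set M3 : Set (SiteConfig (Site 2)) := triMonoPlateV Φ δ (1 + 11 * κ / 20) (1 - 11 * κ / 20) (1 + 11 * κ / 20) with hM3
  set MHZ : Set (BondConfig (Site 2)) := zdMonoPlateH Φ δ (1 + 3 * κ / 5) (1 + 4 * κ / 5) (1 - 3 * κ / 5) with hMHZ
  set M4 : Set (SiteConfig (Site 2)) := triMonoPlateH Φ δ (1 + 3 * κ / 10) (1 + 11 * κ / 20) (1 - 3 * κ / 10) with hM4
  -- bad-set probabilities
  have hPCl : P.real Clᶜ < η := by
    rw [measureReal_def]
    exact ENNReal.toReal_lt_of_lt_ofReal hPbad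
  have hPGZ : P.real (Prod.fst ⁻¹' GZᶜ) ≤ ε / 4 := by
    refine (measureReal_preimage_fst_le_of_map_eq' hP1 _).trans ?_
    have hsub : GZᶜ ⊆ {ω | ¬ (ω ∉ annulusOpenCrossing 0 δ W₀ W₁ ∧ ω ∉ annulusDualCrossing 0 δ W₀ W₁)} ∪ {ω | ¬ ω ⊆ (zdGraph 2).edgeSet} := by
      intro ω hω
      simp only [hGZ, mem_compl_iff, mem_setOf_eq, not_and_or] at hω
      simp only [mem_union, mem_setOf_eq, not_and_or]
      exact hω
    refine (measureReal_mono hsub).trans ((measureReal_union_le _ _).trans ?_)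
    have h0 : (bondPercolation (zdGraph 2) half).real {ω : BondConfig (Site 2) | ¬ ω ⊆ (zdGraph 2).edgeSet} = 0 := by
      rw [measureReal_def, ae_iff.1 (ae_subset_edgeSet (zdGraph 2) half), ENNReal.toReal_zero]
    rw [h0, add_zero]
    exact (hwin δ hδpos hδw').1
  have hPGT : P.real (Prod.snd ⁻¹' GTᶜ) ≤ ε / 4 :=
    (measureReal_preimage_snd_le_of_map_eq' hP2 _).trans (hwin δ hδpos hδw').2
  -- measurability of the four plate events
  have hbox₁ : ∀ {a b : ℝ}, 0 ≤ a → a ≤ 2 → 0 ≤ b → b ≤ 2 → plateBox a b ⊆ plateBox 2 2 := by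
    intro a b ha ha2 hb hb2 z hz
    exact ⟨⟨by linarith [hz.1.1], by linarith [hz.1.2]⟩, ⟨by linarith [hz.2.1], by linarith [hz.2.2]⟩⟩
  have hcm : Measurable (compl : SiteConfig (Site 2) → SiteConfig (Site 2)) :=
    measurable_set_iff.2 fun i => (measurable_set_mem i).not
  have hM3m : MeasurableSet M3 :=
    (measurableSet_triPlate hWc hδpos (hbox₁ (by linarith) (by linarith) (by linarith) (by linarith)) _ _).union
      (hcm (measurableSet_triPlate hWc hδpos (hbox₁ (by linarith) (by linarith) (by linarith) (by linarith)) _ _))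
  have hMHZm : MeasurableSet MHZ :=
    (measurableSet_openCrossing_site' _ _ _).union (measurable_dualConfig (measurableSet_openCrossing_site' _ _ _))
  -- (a) the inclusion behind `(triSitePercolation half)(M3) ≤ (bondPercolation (zdGraph 2) half)(MVZ) + ε`
  have hincl_a : Prod.snd ⁻¹' M3 ⊆ Prod.fst ⁻¹' MVZ ∪ (Clᶜ ∪ Prod.fst ⁻¹' GZᶜ ∪ Prod.snd ⁻¹' GTᶜ) := by
    rintro ⟨ω, ω'⟩ hM
    by_contra hcon
    simp only [mem_union, mem_preimage, mem_compl_iff, not_or, not_not] at hcon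
    obtain ⟨hMV, ⟨hC, hgz⟩, hgt⟩ := hcon
    obtain ⟨hwz, hE⟩ := hgz
    -- duality on ℤ²: both horizontal crossings of H(x'-2ν, x', yin'+2ν)
    have hdz := (hdualZ δ hδpos hδ₁' ω hE).1 (1 + 4 * κ / 5) (1 - 4 * κ / 5) (1 + 4 * κ / 5)
      (by linarith) (by linarith) (by linarith) (by linarith) (by linarith)
    simp only [hMVZ, zdMonoPlateV, mem_union, mem_preimage, not_or] at hMV
    have hHd := hdz.1 hMV.1
    have hHp := hdz.2 hMV.2
    -- transfer to 𝕋
    have key := hT2'' δ hδpos hδ₄' W₀ W₁ hW hW₀₁ hηW (1 + 4 * κ / 5 - 2 * (κ / 20)) (1 + 4 * κ / 5)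
      (1 - 4 * κ / 5 + 2 * (κ / 20)) (by linarith) (by linarith) (by linarith) (by linarith) (by linarith)
      ω ω' hE hC hwz hgt hHp hHd (1 + 11 * κ / 20) (by linarith)
    have e1 : 1 + 4 * κ / 5 - 2 * (κ / 20) - 3 * κ / 20 = 1 + 11 * κ / 20 := by ring
    have e2 : 1 - 4 * κ / 5 + 2 * (κ / 20) + 3 * κ / 20 = 1 - 11 * κ / 20 := by ring
    rw [e1, e2] at key
    exact key hM
  -- (b) the inclusion behind `(bondPercolation (zdGraph 2) half)(MHZ) ≤ (triSitePercolation half)(M4) + ε`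
  have hincl_b : Prod.fst ⁻¹' MHZ ⊆ Prod.snd ⁻¹' M4 ∪ (Clᶜ ∪ Prod.fst ⁻¹' GZᶜ ∪ Prod.snd ⁻¹' GTᶜ) := by
    rintro ⟨ω, ω'⟩ hM
    by_contra hcon
    simp only [mem_union, mem_preimage, mem_compl_iff, not_or, not_not] at hcon
    obtain ⟨hM4', ⟨hC, hgz⟩, hgt⟩ := hcon
    obtain ⟨hwz, hE⟩ := hgz
    -- duality on 𝕋: both vertical crossings of V(xin₄+2ν, y₄-2ν, y₄)
    have hdt := (hdualT δ hδpos hδ₂' ω').2 (1 + 3 * κ / 10) (1 + 11 * κ / 20) (1 - 3 * κ / 10)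
      (by linarith) (by linarith) (by linarith) (by linarith) (by linarith)
    simp only [hM4, triMonoPlateH, mem_union, mem_preimage, not_or] at hM4'
    have hVc := hdt.1 hM4'.1
    have hVo := hdt.2 hM4'.2
    have key := hT1'' δ hδpos hδ₃' W₀ W₁ hW hW₀₁ hηW (1 + 3 * κ / 10 + 2 * (κ / 20))
      (1 - 3 * κ / 10 - 2 * (κ / 20)) (1 - 3 * κ / 10) (by linarith) (by linarith) (by linarith)
      (by linarith) (by linarith) ω ω' hE hC hwz hgt hVo hVc (1 + 4 * κ / 5) (by linarith)
    have e1 : 1 + 3 * κ / 10 + 2 * (κ / 20) + κ / 5 = 1 + 3 * κ / 5 := by ring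
    have e2 : 1 - 3 * κ / 10 - 2 * (κ / 20) - κ / 5 = 1 - 3 * κ / 5 := by ring
    rw [e1, e2] at key
    exact key hM
  -- probabilities
  have hbad : P.real (Clᶜ ∪ Prod.fst ⁻¹' GZᶜ ∪ Prod.snd ⁻¹' GTᶜ) ≤ 3 * ε / 4 := by
    calc P.real (Clᶜ ∪ Prod.fst ⁻¹' GZᶜ ∪ Prod.snd ⁻¹' GTᶜ)
        ≤ P.real (Clᶜ ∪ Prod.fst ⁻¹' GZᶜ) + P.real (Prod.snd ⁻¹' GTᶜ) := measureReal_union_le _ _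
      _ ≤ P.real Clᶜ + P.real (Prod.fst ⁻¹' GZᶜ) + P.real (Prod.snd ⁻¹' GTᶜ) := by
          gcongr; exact measureReal_union_le _ _
      _ ≤ 3 * ε / 4 := by linarith [hPCl.le]
  constructor
  · have h1 : (triSitePercolation half).real M3 = P.real (Prod.snd ⁻¹' M3) := by
      rw [← hP2, map_measureReal_apply measurable_snd hM3m]
    have h2 : P.real (Prod.fst ⁻¹' MVZ) ≤ (bondPercolation (zdGraph 2) half).real MVZ := measureReal_preimage_fst_le_of_map_eq' hP1 _
    have h3 : P.real (Prod.snd ⁻¹' M3) ≤ P.real (Prod.fst ⁻¹' MVZ) + P.real (Clᶜ ∪ Prod.fst ⁻¹' GZᶜ ∪ Prod.snd ⁻¹' GTᶜ) :=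
      (measureReal_mono hincl_a).trans (measureReal_union_le _ _)
    rw [h1]
    linarith
  · have h1 : (bondPercolation (zdGraph 2) half).real MHZ = P.real (Prod.fst ⁻¹' MHZ) := by
      rw [← hP1, map_measureReal_apply measurable_fst hMHZm]
    have h2 : P.real (Prod.snd ⁻¹' M4) ≤ (triSitePercolation half).real M4 := measureReal_preimage_snd_le_of_map_eq' hP2 _
    have h3 : P.real (Prod.fst ⁻¹' MHZ) ≤ P.real (Prod.snd ⁻¹' M4) + P.real (Clᶜ ∪ Prod.fst ⁻¹' GZᶜ ∪ Prod.snd ⁻¹' GTᶜ) :=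
      (measureReal_mono hincl_b).trans (measureReal_union_le _ _)
    rw [h1]
    linarith

/-- **Stub C from S0–S3.** [folklore] -/
theorem transfer_of_pieces
    (h0 : ∀ (Q : ConformalRectangle) (Φ : ℂ ≃ₜ ℂ), IsSquareModel Q Φ → ∀ r : ℝ, 0 < r →
      ∃ κ : ℝ, 0 < κ ∧ κ ≤ 1 / 2 ∧ ∀ δ : ℝ, 0 < δ →
        zdPlateV (meshPoint δ) Φ (1 + κ) (1 - κ) (1 + κ) ⊆
          openCrossing {x : Site 2 | meshPoint δ x ∈ cthickening r Q.carrier}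
            {x | meshPoint δ x ∈ cthickening r (Q.arc 0)} {x | meshPoint δ x ∈ cthickening r (Q.arc 2)})
    (h1 : ∀ (Φ : ℂ ≃ₜ ℂ) (κ : ℝ), 0 < κ → κ ≤ 1 / 2 → ∀ᶠ δ : ℝ in 𝓝[>] 0,
      (bondPercolation (zdGraph 2) half).real (zdMonoPlateV Φ δ (1 + 4 * κ / 5) (1 - 4 * κ / 5) (1 + 4 * κ / 5)) + 1 -
          (bondPercolation (zdGraph 2) half).real (zdMonoPlateH Φ δ (1 + 3 * κ / 5) (1 + 4 * κ / 5) (1 - 3 * κ / 5)) ≤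
        2 * (bondPercolation (zdGraph 2) half).real (zdPlateV (meshPoint δ) Φ (1 + κ) (1 - κ) (1 + κ)))
    (h2 : ∀ (Q : ConformalRectangle) (Φ : ℂ ≃ₜ ℂ), IsSquareModel Q Φ → ∀ κ : ℝ, 0 < κ → κ ≤ 1 / 2 →
      ∀ᶠ δ : ℝ in 𝓝[>] 0,
        2 * triDomainCrossingProb Q δ ≤
          (triSitePercolation half).real (triMonoPlateV Φ δ (1 + 11 * κ / 20) (1 - 11 * κ / 20) (1 + 11 * κ / 20)) + 1 -
            (triSitePercolation half).real (triMonoPlateH Φ δ (1 + 3 * κ / 10) (1 + 11 * κ / 20) (1 - 3 * κ / 10)))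
    (h3 : LoopLimitZ2EqT → ∀ (Φ : ℂ ≃ₜ ℂ) (κ : ℝ), 0 < κ → κ ≤ 1 / 2 → ∀ ε : ℝ, 0 < ε →
      ∀ᶠ δ : ℝ in 𝓝[>] 0,
        (triSitePercolation half).real (triMonoPlateV Φ δ (1 + 11 * κ / 20) (1 - 11 * κ / 20) (1 + 11 * κ / 20)) ≤
            (bondPercolation (zdGraph 2) half).real (zdMonoPlateV Φ δ (1 + 4 * κ / 5) (1 - 4 * κ / 5) (1 + 4 * κ / 5)) + ε ∧
          (bondPercolation (zdGraph 2) half).real (zdMonoPlateH Φ δ (1 + 3 * κ / 5) (1 + 4 * κ / 5) (1 - 3 * κ / 5)) ≤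
            (triSitePercolation half).real (triMonoPlateH Φ δ (1 + 3 * κ / 10) (1 + 11 * κ / 20) (1 - 3 * κ / 10)) + ε) :
    LoopLimitZ2EqT →
      ∀ (Q : ConformalRectangle) (r : ℝ), 0 < r → ∀ ε : ℝ, 0 < ε →
        ∀ᶠ δ : ℝ in 𝓝[>] 0,
          triDomainCrossingProb Q δ ≤
            (bondPercolation (zdGraph 2) half).real
              (openCrossing {x : Site 2 | meshPoint δ x ∈ cthickening r Q.carrier}
                {x | meshPoint δ x ∈ cthickening r (Q.arc 0)}
                {x | meshPoint δ x ∈ cthickening r (Q.arc 2)}) + ε := by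
  intro hX Q r hr ε hε
  obtain ⟨Φ, hΦ⟩ := exists_isSquareModel Q
  obtain ⟨κ, hκ, hκ1, hcont⟩ := h0 Q Φ hΦ r hr
  have e1 := h1 Φ κ hκ hκ1
  have e2 := h2 Q Φ hΦ κ hκ hκ1
  have e3 := h3 hX Φ κ hκ hκ1 ε hε
  filter_upwards [e1, e2, e3, eventually_mem_nhdsWithin] with δ hδ1 hδ2 hδ3 hδpos
  rw [mem_Ioi] at hδpos
  have hmono : (bondPercolation (zdGraph 2) half).real (zdPlateV (meshPoint δ) Φ (1 + κ) (1 - κ) (1 + κ)) ≤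
      (bondPercolation (zdGraph 2) half).real
        (openCrossing {x : Site 2 | meshPoint δ x ∈ cthickening r Q.carrier}
          {x | meshPoint δ x ∈ cthickening r (Q.arc 0)} {x | meshPoint δ x ∈ cthickening r (Q.arc 2)}) :=
    measureReal_mono (hcont δ hδpos)
  linarith [hδ3.1, hδ3.2]

/-- **T2 — horizontal loop sub-arcs transfer from `ℤ²` to `𝕋`, from T2a and T2b** (the statement
consumed by stub C's plan as `TransferHorizontalZtoT`, in the tree's plate vocabulary; the glue is the
lead's `transferHorizontalZtoT_of`). [folklore] -/
theorem transferHorizontalZtoT_of_stubs :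
    ∀ (Φ : ℂ ≃ₜ ℂ) (c : ℝ), 0 < c → ∃ η₀ : ℝ, 0 < η₀ ∧ ∀ η : ℝ, 0 < η → η ≤ η₀ →
      ∃ δ₀ : ℝ, 0 < δ₀ ∧ ∀ δ : ℝ, 0 < δ → δ ≤ δ₀ →
        ∀ (W₀ W₁ : ℝ), Φ '' plateBox 2 2 ⊆ ball (0 : ℂ) W₀ → W₀ < W₁ → W₁ + 1 ≤ 1 / η →
        ∀ (xin xout y : ℝ), 2 * c ≤ xin → xin ≤ xout → xout ≤ 2 → c ≤ y → y + c ≤ 2 →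
        ∀ (ω : BondConfig (Site 2)) (ω' : SiteConfig (Site 2)), ω ⊆ (zdGraph 2).edgeSet →
          LoopConfig.IsClose η (bondLoopConfig δ 0 ω) (siteLoopConfig δ ω') →
          (ω ∉ annulusOpenCrossing 0 δ W₀ W₁ ∧ ω ∉ annulusDualCrossing 0 δ W₀ W₁) →
          (ω' ∉ triAnnulusCrossing true δ 0 W₀ W₁ ∧ ω' ∉ triAnnulusCrossing false δ 0 W₀ W₁) →
          ω ∈ zdPlateH (meshPoint δ) Φ xin xout y → dualConfig ω ∈ zdPlateH (dualDraw δ) Φ xin xout y →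
          ∀ yout' : ℝ, yout' ≤ 2 → ω' ∉ triMonoPlateV Φ δ (xin - c) (y + c) yout' := by
  intro Φ c hc
  obtain ⟨η₁, hη₁, hB1⟩ := stub_triBlockedByCloseArc Φ c hc
  refine ⟨η₁, hη₁, fun η hη hηle ↦ ?_⟩
  obtain ⟨δa, hδa, hA'⟩ := stub_zdLoopArc Φ c hc
  obtain ⟨δ₁, hδ₁, hB1'⟩ := hB1 η hη hηle
  refine ⟨min δa δ₁, lt_min hδa hδ₁, fun δ hδ hδle ↦ ?_⟩
  intro W₀ W₁ hW hW₀₁ hηW xin xout y hxin hxio hxout hy hy2 ω ω' hE hC hwz _hwt hHp hHd yout' hyout'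
  obtain ⟨γ, hγ, hrange, α, s, t, hα, hst, hband, hleft, hright⟩ :=
    hA' δ hδ (hδle.trans (min_le_left _ _)) W₀ W₁ hW hW₀₁ xin xout y hxin hxio hxout hy hy2 ω hE hwz hHp hHd
  have hrange' : (loopCurve δ 0 γ).range ⊆ ball (0 : ℂ) (1 / η) :=
    hrange.trans (ball_subset_ball hηW)
  exact hB1' δ hδ (hδle.trans (min_le_right _ _)) xin y hxin (hxio.trans hxout) hy hy2 ω ω' hC γ hγ
    hrange' α s t hα hst hband hleft hright yout' hyout'

/-- **Glue for T1** (lead, sorry-free): the registered `stub_transferVerticalTtoZ` (conclusion as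
a conjunction of two exclusions) in the union form consumed by `monoTransfer_of`. [folklore] -/
theorem transferVerticalTtoZ_of_stub :
    ∀ (Φ : ℂ ≃ₜ ℂ) (c : ℝ), 0 < c → ∃ η₀ : ℝ, 0 < η₀ ∧ ∀ η : ℝ, 0 < η → η ≤ η₀ →
      ∃ δ₀ : ℝ, 0 < δ₀ ∧ ∀ δ : ℝ, 0 < δ → δ ≤ δ₀ →
        ∀ (W₀ W₁ : ℝ), Φ '' plateBox 2 2 ⊆ ball (0 : ℂ) W₀ → W₀ < W₁ → W₁ + 1 ≤ 1 / η →
        ∀ (x yin yout : ℝ), c ≤ x → x + c ≤ 2 → 2 * c ≤ yin → yin ≤ yout → yout ≤ 2 →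
        ∀ (ω : BondConfig (Site 2)) (ω' : SiteConfig (Site 2)), ω ⊆ (zdGraph 2).edgeSet →
          LoopConfig.IsClose η (bondLoopConfig δ 0 ω) (siteLoopConfig δ ω') →
          (ω ∉ annulusOpenCrossing 0 δ W₀ W₁ ∧ ω ∉ annulusDualCrossing 0 δ W₀ W₁) →
          (ω' ∉ triAnnulusCrossing true δ 0 W₀ W₁ ∧ ω' ∉ triAnnulusCrossing false δ 0 W₀ W₁) →
          ω' ∈ triPlateV Φ δ x yin yout → ω'ᶜ ∈ triPlateV Φ δ x yin yout →
          ∀ xout : ℝ, xout ≤ 2 → ω ∉ zdMonoPlateH Φ δ (x + c) xout (yin - c) := by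
  intro Φ c hc
  obtain ⟨η₀, hη₀, h1⟩ := stub_transferVerticalTtoZ Φ c hc
  refine ⟨η₀, hη₀, fun η hη hηle ↦ ?_⟩
  obtain ⟨δ₀, hδ₀, h2⟩ := h1 η hη hηle
  refine ⟨δ₀, hδ₀, fun δ hδ hδle ↦ ?_⟩
  intro W₀ W₁ hW hW₀₁ hηW x yin yout hx hx2 hyin hyio hyout ω ω' hE hC hwz hwt hVo hVc xout hxout hmem
  have key := h2 δ hδ hδle W₀ W₁ hW hW₀₁ hηW x yin yout hx hx2 hyin hyio hyout ω ω' hE hC hwz hwt hVo hVc xout hxout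
  rcases hmem with h | h
  · exact key.1 h
  · exact key.2 h

/-- **Stub C** (`stub_transfer_tri_to_bond`, registered statement): under `X`, the 𝕋 crossing
probability of `Q` is eventually at most the bond plate-path probability of `(Q, r)` plus `ε`.
Assembly `transfer_of_pieces` of S0 (`plateContainment_holds`), S1 (`polarZ_of` + stub G1),
S2 (`polarT_of` + stubs G2, B), S3 (`monoTransfer_of` + stubs G1, G2, T1, T2a, T2b).
[cite: CamiaNewman2006, §5–6] -/
theorem stub_transfer_tri_to_bond :
    LoopLimitZ2EqT →
      ∀ (Q : ConformalRectangle) (r : ℝ), 0 < r → ∀ ε : ℝ, 0 < ε →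
        ∀ᶠ δ : ℝ in 𝓝[>] 0,
          triDomainCrossingProb Q δ ≤
            (bondPercolation (zdGraph 2) half).real
              (openCrossing {x : Site 2 | meshPoint δ x ∈ cthickening r Q.carrier}
                {x | meshPoint δ x ∈ cthickening r (Q.arc 0)}
                {x | meshPoint δ x ∈ cthickening r (Q.arc 2)}) + ε :=
  transfer_of_pieces plateContainment_holds (polarZ_of stub_zdPlateDuality)
    (polarT_of stub_triPlateDuality stub_plusBlocking.2.2)
    (monoTransfer_of stub_zdPlateDuality stub_triPlateDuality transferVerticalTtoZ_of_stub
      transferHorizontalZtoT_of_stubs)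

end Summit.CriticalPhenomena.CardyFormulaZ2.Cruxes.LoopsToCrossings.OracleSandwich

end
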